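import Summits.HodgeConjecture.HodgeCM.Model.ArchKTypeOfMultOne_1

/-! PORT of `HodgeCM/Model/ArchKTypeOfMultOne.lean` (HodgeCMPerL run 82) — part 2: continuation of `Summits.HodgeConjecture.HodgeCM.Model.ArchKTypeOfMultOne_1` (split at a top-level declaration boundary by port_pkg.py; scope re-opened below; declarations unchanged). -/

-- port_pkg: scope re-opened for this part (file-level context, then the namespace/section stack open at the cut)
set_option autoImplicit false
noncomputable section
open NumberField NumberField.InfinitePlace NumberField.mixedEmbedding IsDedekindDomain MeasureTheory
open scoped Matrix TensorProduct Classical SchwartzMap ComplexConjugate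
open Literature.NumberTheory.Automorphic Literature.NumberTheory.Weil1964
open Literature.RepresentationTheory.KonnoKonno2007 Literature.RepresentationTheory.KonnoKonno2007.RealDualPair
open Literature.NumberTheory.GelbartRogawski1991 Literature.NumberTheory.GelbartRogawski1991.UnitaryDualPair
open Literature.Analysis.SegalBargmann
namespace HodgeCM.Model.MultOne
open HodgeCM.Model HodgeCM.Model.HypCensus MulAction
open Literature.Geometry.ComplexHyperbolic.BallModel (U21 x₀ stabilizerEquivK21 blockU blockK mat bmat mat_blockU coe_blockK)
open Literature.NumberTheory.Automorphic.U21 (K21 matA sclD pPlus pPlus_apply)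
open Literature.AlgebraicGeometry.ShimuraVarieties.BallForms (isPullbackCocycle_cotangentCocycle weightOf_cotangent_dual_apply)
section Letters
open HodgeCM.Model.ArchSideTerm (e₁)
variable {L : CMField} {ι₁ : L →+* ℂ} (V : HermSpace3 L ι₁) (d : (L : Type)) (hd : IsCMField.complexConj L d = d) (hd0 : d ≠ 0)
/-- **LEMMA X: the `v₁`-letter of the torus letter `t` is the letter of the diagonal element `(diag (alphaOf t), betaOf t)`.** -/
theorem letterOfK_kDiag (t : Fin 3 × {v : InfinitePlace ↥(maximalRealSubfield L) // v.IsReal} → Circle) :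
    letterOfK V (kDiag (alphaOf V d hd t) (betaOf V d hd t)) =
      torusLetterV (L : Type) e₁ (frameD V) (frameD_real V) (lineVec (L : Type) d) (fun _ => hd) ι₁ t (cmPlace (L : Type) ι₁) := by
  refine Prod.ext ?_ ?_
  · apply Subtype.ext
    ext p q
    change ((diagHom (alphaOf V d hd t) : Matrix.unitaryGroup (Fin 2) ℂ) : Matrix (Fin 2) (Fin 2) ℂ) (blockPosEquiv V p) (blockPosEquiv V q) = _
    rw [torusLetterV, coe_diagHom', coe_diagHom']
    by_cases hpq : p = q
    · subst hpq
      rw [Matrix.diagonal_apply_eq, Matrix.diagonal_apply_eq, alphaOf, Equiv.symm_apply_apply]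
    · rw [Matrix.diagonal_apply_ne _ fun h => hpq ((blockPosEquiv V).injective h), Matrix.diagonal_apply_ne _ hpq]
  · apply Subtype.ext
    ext p q
    have hp : p = (blockNegEquiv V).symm () := (blockNegEquiv V).injective (Subsingleton.elim _ _)
    have hq : q = p := (blockNegEquiv V).injective (Subsingleton.elim _ _)
    subst hq
    change ((betaOf V d hd t : Circle) : ℂ) = _
    rw [torusLetterV, coe_diagHom', Matrix.diagonal_apply_eq, betaOf, ← hp]

/-- the AWAY part of `t`: its `v₁`-column replaced by `1`. -/
def awayT (L : CMField) (ι₁ : L →+* ℂ) (t : Fin 3 × {v : InfinitePlace ↥(maximalRealSubfield L) // v.IsReal} → Circle) :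
    Fin 3 × {v : InfinitePlace ↥(maximalRealSubfield L) // v.IsReal} → Circle :=
  fun l => if l.2 = cmPlace (L : Type) ι₁ then 1 else t l

/-- (Ported verbatim from the HodgeCMPerL package; no docstring in the source.) -/
theorem torusLetter_awayT_cmPlace (t : Fin 3 × {v : InfinitePlace ↥(maximalRealSubfield L) // v.IsReal} → Circle) :
    torusLetter (L : Type) e₁ (frameD V) (frameD_real V) (lineVec (L : Type) d) (fun _ => hd) ι₁ (awayT L ι₁ t) (cmPlace (L : Type) ι₁) = 1 := by
  refine Prod.ext (Prod.ext ?_ ?_) rfl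
  · change diagHom _ = 1
    rw [← map_one (diagHom (σ := PosIdx (cmXV (L : Type) (frameD V) (frameD_real V) ι₁ (cmPlace (L : Type) ι₁))))]
    congr 1; funext p; simp [awayT]
  · change diagHom _ = 1
    rw [← map_one (diagHom (σ := NegIdx (cmXV (L : Type) (frameD V) (frameD_real V) ι₁ (cmPlace (L : Type) ι₁))))]
    congr 1; funext q; simp [awayT]

/-- (Ported verbatim from the HodgeCMPerL package; no docstring in the source.) -/
theorem torusLetter_awayT_of_ne (t : Fin 3 × {v : InfinitePlace ↥(maximalRealSubfield L) // v.IsReal} → Circle)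
    {v : {v : InfinitePlace ↥(maximalRealSubfield L) // v.IsReal}} (hv : v ≠ cmPlace (L : Type) ι₁) :
    torusLetter (L : Type) e₁ (frameD V) (frameD_real V) (lineVec (L : Type) d) (fun _ => hd) ι₁ (awayT L ι₁ t) v =
      torusLetter (L : Type) e₁ (frameD V) (frameD_real V) (lineVec (L : Type) d) (fun _ => hd) ι₁ t v := by
  refine Prod.ext (Prod.ext ?_ ?_) rfl
  · change diagHom _ = diagHom _
    congr 1; funext p; simp [awayT, hv]
  · change diagHom _ = diagHom _
    congr 1; funext q; simp [awayT, hv]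

/-- **decomposition of a torus letter** into its `v₁`-letter and its away part. -/
theorem torusLetter_eq_mulSingle_mul_awayT (t : Fin 3 × {v : InfinitePlace ↥(maximalRealSubfield L) // v.IsReal} → Circle) :
    torusLetter (L : Type) e₁ (frameD V) (frameD_real V) (lineVec (L : Type) d) (fun _ => hd) ι₁ t =
      Pi.mulSingle (cmPlace (L : Type) ι₁)
          (torusLetter (L : Type) e₁ (frameD V) (frameD_real V) (lineVec (L : Type) d) (fun _ => hd) ι₁ t (cmPlace (L : Type) ι₁)) *
        torusLetter (L : Type) e₁ (frameD V) (frameD_real V) (lineVec (L : Type) d) (fun _ => hd) ι₁ (awayT L ι₁ t) := by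
  funext v
  rw [Pi.mul_apply]
  by_cases hv : v = cmPlace (L : Type) ι₁
  · subst hv
    rw [Pi.mulSingle_eq_same, torusLetter_awayT_cmPlace, mul_one]
  · rw [Pi.mulSingle_eq_of_ne hv, one_mul, torusLetter_awayT_of_ne V d hd t hv]

end Letters

/-! ## § 7. MAIN: the admissible archimedean families of a line slot have rank at most one -/

section Main

open HodgeCM.Model.ArchSideTerm (e₁)

variable {L : CMField} {ι₁ : L →+* ℂ} (V : HermSpace3 L ι₁) (d : (L : Type)) (hd : IsCMField.complexConj L d = d) (hd0 : d ≠ 0)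
  (hGRd : (cmSplittingDatum (L : Type) e₁ (frameD V) (frameD_real V) (frameD_ne V) (lineVec (L : Type) d) (fun _ => hd)
    (fun _ => hd0)).CompatibleSplitting)
  (χU : U21 →* ℂˣ) (c' : UnitaryGroup.arch (↥(maximalRealSubfield L)) L (IsCMField.complexConj L) 3 V.Hm → ℂˣ)

include hd hd0 in
/-- `h₁W` of a line: a real non-zero `d` has `re ι₁(d) ≠ 0`, hence one sign (as #W107 `line_hs₁W_of_real`). -/
theorem line_sign₁ : (∀ j : Fin 1, 0 < (ι₁ (lineVec (L : Type) d j)).re) ∨ ∀ j : Fin 1, (ι₁ (lineVec (L : Type) d j)).re < 0 := by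
  rcases (re_apply_ne_zero_of_complexConj_eq (L : Type) ι₁ hd hd0).lt_or_gt with h | h
  · exact Or.inr fun _ => h
  · exact Or.inl fun _ => h

/-- `hW` of a line is vacuous (one index). -/
theorem line_signW (τ : (L : Type) →+* ℂ) (_hτ : InfinitePlace.mk τ ≠ InfinitePlace.mk ι₁) :
    (∃ j₀ : Fin 1, ∀ j, j ≠ j₀ → 0 < (τ (lineVec (L : Type) d j)).re) ∨ ∀ j, (τ (lineVec (L : Type) d j)).re < 0 :=
  Or.inl ⟨0, fun j hj => absurd (Subsingleton.elim j 0) hj⟩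

set_option maxHeartbeats 800000 in
/-- **MAIN THEOREM (multiplicity at most one of the `K_∞`-type of a line slot).**  Let `ω = cmArchWeilRep e₁ (frameD V) ⟨d⟩ hGR`
be the honest archimedean Weil representation of the line pair `(U(V), U(⟨d⟩))` of the pin of record, `χ` ANY scalar function on
`U(2,1)` and `c′` ANY scalar function on `U(V)(L ⊗ ℝ)`.  Two linear families `a, b : W^∨ → 𝓢((L⁺ ⊗ ℝ)³)` which are
(i) `Stab(x₀)`-equivariant of type `τ₁^∨ = (weightOf x₀)^∨` under `u ↦ χ(u) • ω(archSectionFrameOf V u, 1)` and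
(ii) fixed by `c′(aa) • ω(archFrameCongr aa, 1)` for every `aa ∈ U(V)(L ⊗ ℝ)` trivial at the place of `ι₁`,
are PROPORTIONAL (`a ≠ 0 ⇒ b ∈ ℂ a`).  No published fact is used: torus of the oscillator representation (§ 0–§ 6). -/
theorem exists_eq_smul_of_admissible
    (a b : Module.Dual ℂ (Fin 2 → ℂ) →ₗ[ℂ] 𝓢((Fin 3 → mixedSpace (↥(maximalRealSubfield L))), ℂ))
    (ha₁ : ∀ (u : ↥(stabilizer U21 x₀)) (ℓ : Module.Dual ℂ (Fin 2 → ℂ)),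
      ((χU (u : U21) : ℂˣ) : ℂ) • cmArchWeilRep (L : Type) e₁ (frameD V) (frameD_real V) (frameD_ne V) (lineVec (L : Type) d)
        (fun _ => hd) (fun _ => hd0) hGRd (archSectionFrameOf V u, 1) (a ℓ) = a ((isPullbackCocycle_cotangentCocycle.weightOf x₀).dual u ℓ))
    (ha₂ : ∀ aa : UnitaryGroup.arch (↥(maximalRealSubfield L)) L (IsCMField.complexConj L) 3 V.Hm,
      UnitaryGroup.archAt (↥(maximalRealSubfield L)) L (IsCMField.complexConj L) 3 V.Hm (UnitaryGroup.cmPlace (L : Type) ι₁)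
          (NumberField.complexConj_smul_infinitePlace (L : Type) _) (IsCMField.complexConj_ne_one (L : Type)) aa = 1 →
      ∀ ℓ : Module.Dual ℂ (Fin 2 → ℂ), ((c' aa : ℂˣ) : ℂ) • cmArchWeilRep (L : Type) e₁ (frameD V) (frameD_real V) (frameD_ne V)
        (lineVec (L : Type) d) (fun _ => hd) (fun _ => hd0) hGRd (archFrameCongr (L : Type) V.Hm (frameG V) (frameD V) (frame_congr V) aa, 1)
          (a ℓ) = a ℓ)
    (hb₁ : ∀ (u : ↥(stabilizer U21 x₀)) (ℓ : Module.Dual ℂ (Fin 2 → ℂ)),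
      ((χU (u : U21) : ℂˣ) : ℂ) • cmArchWeilRep (L : Type) e₁ (frameD V) (frameD_real V) (frameD_ne V) (lineVec (L : Type) d)
        (fun _ => hd) (fun _ => hd0) hGRd (archSectionFrameOf V u, 1) (b ℓ) = b ((isPullbackCocycle_cotangentCocycle.weightOf x₀).dual u ℓ))
    (hb₂ : ∀ aa : UnitaryGroup.arch (↥(maximalRealSubfield L)) L (IsCMField.complexConj L) 3 V.Hm,
      UnitaryGroup.archAt (↥(maximalRealSubfield L)) L (IsCMField.complexConj L) 3 V.Hm (UnitaryGroup.cmPlace (L : Type) ι₁)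
          (NumberField.complexConj_smul_infinitePlace (L : Type) _) (IsCMField.complexConj_ne_one (L : Type)) aa = 1 →
      ∀ ℓ : Module.Dual ℂ (Fin 2 → ℂ), ((c' aa : ℂˣ) : ℂ) • cmArchWeilRep (L : Type) e₁ (frameD V) (frameD_real V) (frameD_ne V)
        (lineVec (L : Type) d) (fun _ => hd) (fun _ => hd0) hGRd (archFrameCongr (L : Type) V.Hm (frameG V) (frameD V) (frame_congr V) aa, 1)
          (b ℓ) = b ℓ)
    (ha0 : a ≠ 0) : ∃ r : ℂ, b = r • a := by
  set ω := cmArchWeilRep (L : Type) e₁ (frameD V) (frameD_real V) (frameD_ne V) (lineVec (L : Type) d) (fun _ => hd) (fun _ => hd0) hGRd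
    with hω
  -- the eigenvalue function of the torus letters on `x ell₁`, `x` admissible
  let aaOf : (Fin 3 × {v : InfinitePlace ↥(maximalRealSubfield L) // v.IsReal} → Circle) →
      UnitaryGroup.arch (↥(maximalRealSubfield L)) L (IsCMField.complexConj L) 3 V.Hm := fun t =>
    archFrameLift V (letterSection (L : Type) (frameD V) (frameD_real V) (frameD_ne V) (lineVec (L : Type) d) (fun _ => hd) (fun _ => hd0) ι₁
      (torusLetter (L : Type) e₁ (frameD V) (frameD_real V) (lineVec (L : Type) d) (fun _ => hd) ι₁ (awayT L ι₁ t))).1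
  let kOf : (Fin 3 × {v : InfinitePlace ↥(maximalRealSubfield L) // v.IsReal} → Circle) → K21 := fun t =>
    kDiag (fun i => twC L ι₁ (alphaOf V d hd t i)) (twC L ι₁ (betaOf V d hd t))
  -- (1) every admissible family gives a joint eigenvector of the torus letters at `ell₁`
  have eigen : ∀ x : Module.Dual ℂ (Fin 2 → ℂ) →ₗ[ℂ] 𝓢((Fin 3 → mixedSpace (↥(maximalRealSubfield L))), ℂ),
      (∀ (u : ↥(stabilizer U21 x₀)) (ℓ : Module.Dual ℂ (Fin 2 → ℂ)),
        ((χU (u : U21) : ℂˣ) : ℂ) • ω (archSectionFrameOf V u, 1) (x ℓ) = x ((isPullbackCocycle_cotangentCocycle.weightOf x₀).dual u ℓ)) →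
      (∀ aa : UnitaryGroup.arch (↥(maximalRealSubfield L)) L (IsCMField.complexConj L) 3 V.Hm,
        UnitaryGroup.archAt (↥(maximalRealSubfield L)) L (IsCMField.complexConj L) 3 V.Hm (UnitaryGroup.cmPlace (L : Type) ι₁)
            (NumberField.complexConj_smul_infinitePlace (L : Type) _) (IsCMField.complexConj_ne_one (L : Type)) aa = 1 →
        ∀ ℓ : Module.Dual ℂ (Fin 2 → ℂ), ((c' aa : ℂˣ) : ℂ) •
          ω (archFrameCongr (L : Type) V.Hm (frameG V) (frameD V) (frame_congr V) aa, 1) (x ℓ) = x ℓ) →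
      ∀ t, ω (letterSection (L : Type) (frameD V) (frameD_real V) (frameD_ne V) (lineVec (L : Type) d) (fun _ => hd) (fun _ => hd0) ι₁
          (torusLetter (L : Type) e₁ (frameD V) (frameD_real V) (lineVec (L : Type) d) (fun _ => hd) ι₁ t)) (x ell₁) =
        ((((c' (aaOf t) : ℂˣ) : ℂ))⁻¹ * ((((χU (blockU (kOf t)) : ℂˣ) : ℂ))⁻¹ *
          (star ((twC L ι₁ (betaOf V d hd t) : Circle) : ℂ) * ((twC L ι₁ (alphaOf V d hd t 0) : Circle) : ℂ)))) • x ell₁ := by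
    intro x hx₁ hx₂ t
    -- the away part
    have haway := letterSection_away V d hd hd0
      (torusLetter (L : Type) e₁ (frameD V) (frameD_real V) (lineVec (L : Type) d) (fun _ => hd) ι₁ (awayT L ι₁ t)) (fun _ => rfl)
      (torusLetter_awayT_cmPlace V d hd t)
    have hy : letterSection (L : Type) (frameD V) (frameD_real V) (frameD_ne V) (lineVec (L : Type) d) (fun _ => hd) (fun _ => hd0) ι₁
        (torusLetter (L : Type) e₁ (frameD V) (frameD_real V) (lineVec (L : Type) d) (fun _ => hd) ι₁ (awayT L ι₁ t)) =
        (archFrameCongr (L : Type) V.Hm (frameG V) (frameD V) (frame_congr V) (aaOf t), 1) := by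
      rw [archFrameCongr_archFrameLift]; exact Prod.ext rfl haway.2
    have haa : UnitaryGroup.archAt (↥(maximalRealSubfield L)) L (IsCMField.complexConj L) 3 V.Hm (UnitaryGroup.cmPlace (L : Type) ι₁)
        (NumberField.complexConj_smul_infinitePlace (L : Type) _) (IsCMField.complexConj_ne_one (L : Type)) (aaOf t) = 1 := by
      have h := archAt_archFrameLift_eq_one V (cmPlaceOver (L : Type) (cmPlace (L : Type) ι₁)) _ haway.1
      rw [cmPlaceOver_cmPlace_eq] at h
      exact h
    have hinner : ω (letterSection (L : Type) (frameD V) (frameD_real V) (frameD_ne V) (lineVec (L : Type) d) (fun _ => hd) (fun _ => hd0) ι₁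
        (torusLetter (L : Type) e₁ (frameD V) (frameD_real V) (lineVec (L : Type) d) (fun _ => hd) ι₁ (awayT L ι₁ t))) (x ell₁) =
        (((c' (aaOf t) : ℂˣ) : ℂ))⁻¹ • x ell₁ := by
      rw [hy, eq_inv_smul_iff₀ (Units.ne_zero _), hx₂ (aaOf t) haa]
    -- the `v₁` part
    have houter : ω (letterSection (L : Type) (frameD V) (frameD_real V) (frameD_ne V) (lineVec (L : Type) d) (fun _ => hd) (fun _ => hd0) ι₁
        (Pi.mulSingle (cmPlace (L : Type) ι₁)
          (torusLetter (L : Type) e₁ (frameD V) (frameD_real V) (lineVec (L : Type) d) (fun _ => hd) ι₁ t (cmPlace (L : Type) ι₁)))) (x ell₁) =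
        ((((χU (blockU (kOf t)) : ℂˣ) : ℂ))⁻¹ * (star ((twC L ι₁ (betaOf V d hd t) : Circle) : ℂ) * ((twC L ι₁ (alphaOf V d hd t 0) : Circle) : ℂ))) •
          x ell₁ := by
      have hsec := archSectionFrameOf_twistU21_blockU V d hd hd0 (kDiag (alphaOf V d hd t) (betaOf V d hd t))
      rw [letterOfK_kDiag, twistU21_blockU_kDiag] at hsec
      rw [torusLetter_apply, ← hsec, ← coe_blockK, mul_smul, eq_inv_smul_iff₀ (Units.ne_zero _)]
      have h1 := hx₁ (blockK (kOf t)) ell₁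
      rw [weightOf_dual_blockK_kDiag, map_smul] at h1
      exact h1
    rw [torusLetter_eq_mulSingle_mul_awayT V d hd t, map_mul, map_mul, Module.End.mul_apply, hinner, map_smul, houter, smul_smul]
  -- (2) `a ell₁ ≠ 0`
  have hswap : ∀ x : Module.Dual ℂ (Fin 2 → ℂ) →ₗ[ℂ] 𝓢((Fin 3 → mixedSpace (↥(maximalRealSubfield L))), ℂ),
      (∀ (u : ↥(stabilizer U21 x₀)) (ℓ : Module.Dual ℂ (Fin 2 → ℂ)),
        ((χU (u : U21) : ℂˣ) : ℂ) • ω (archSectionFrameOf V u, 1) (x ℓ) = x ((isPullbackCocycle_cotangentCocycle.weightOf x₀).dual u ℓ)) →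
      x ell₂ = ((χU (blockU kSwap) : ℂˣ) : ℂ) • ω (archSectionFrameOf V (blockU kSwap), 1) (x ell₁) := by
    intro x hx₁
    rw [← weightOf_dual_blockK_kSwap, ← hx₁ (blockK kSwap) ell₁, coe_blockK]
  have hf0 : a ell₁ ≠ 0 := by
    intro h0
    apply ha0
    refine eq_zero_of_apply_ell a h0 ?_
    rw [hswap a ha₁, h0, map_zero, smul_zero]
  -- (3) the core
  obtain ⟨r, hr⟩ := exists_eq_smul_of_torusLetter_eigen (L : Type) e₁ (frameD V) (frameD_real V) (frameD_ne V) (lineVec (L : Type) d)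
    (fun _ => hd) (fun _ => hd0) hGRd ι₁ (frameD_sign_ι₁' V) (line_sign₁ d hd hd0) (frameD_sign_of_ne V) (line_signW d) _ hf0
    (eigen a ha₁ ha₂) (eigen b hb₁ hb₂)
  -- (4) `b = r • a` on `ell₁` and `ell₂`
  refine ⟨r, ?_⟩
  rw [← sub_eq_zero]
  refine eq_zero_of_apply_ell _ ?_ ?_
  · rw [LinearMap.sub_apply, LinearMap.smul_apply, hr, sub_self]
  · rw [LinearMap.sub_apply, LinearMap.smul_apply, hswap b hb₁, hswap a ha₁, hr, map_smul, smul_comm, sub_self]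

/-- **RANK FORM.**  Every `ℂ`-submodule of linear families `W^∨ → 𝓢((L⁺ ⊗ ℝ)³)` all of whose members satisfy (i) and (ii)
has `Module.rank ℂ ≤ 1` (`rank_submodule_le_one_iff'` + `exists_eq_smul_of_admissible`). -/
theorem rank_le_one_of_admissible
    (P : Submodule ℂ (Module.Dual ℂ (Fin 2 → ℂ) →ₗ[ℂ] 𝓢((Fin 3 → mixedSpace (↥(maximalRealSubfield L))), ℂ)))
    (hP₁ : ∀ a ∈ P, ∀ (u : ↥(stabilizer U21 x₀)) (ℓ : Module.Dual ℂ (Fin 2 → ℂ)),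
      ((χU (u : U21) : ℂˣ) : ℂ) • cmArchWeilRep (L : Type) e₁ (frameD V) (frameD_real V) (frameD_ne V) (lineVec (L : Type) d)
        (fun _ => hd) (fun _ => hd0) hGRd (archSectionFrameOf V u, 1) (a ℓ) = a ((isPullbackCocycle_cotangentCocycle.weightOf x₀).dual u ℓ))
    (hP₂ : ∀ a ∈ P, ∀ aa : UnitaryGroup.arch (↥(maximalRealSubfield L)) L (IsCMField.complexConj L) 3 V.Hm,
      UnitaryGroup.archAt (↥(maximalRealSubfield L)) L (IsCMField.complexConj L) 3 V.Hm (UnitaryGroup.cmPlace (L : Type) ι₁)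
          (NumberField.complexConj_smul_infinitePlace (L : Type) _) (IsCMField.complexConj_ne_one (L : Type)) aa = 1 →
      ∀ ℓ : Module.Dual ℂ (Fin 2 → ℂ), ((c' aa : ℂˣ) : ℂ) • cmArchWeilRep (L : Type) e₁ (frameD V) (frameD_real V) (frameD_ne V)
        (lineVec (L : Type) d) (fun _ => hd) (fun _ => hd0) hGRd (archFrameCongr (L : Type) V.Hm (frameG V) (frameD V) (frame_congr V) aa, 1)
          (a ℓ) = a ℓ) :
    Module.rank ℂ ↥P ≤ 1 := by
  rw [rank_submodule_le_one_iff']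
  by_cases h : ∃ a ∈ P, a ≠ 0
  · obtain ⟨a, haP, ha0⟩ := h
    refine ⟨a, fun b hbP => ?_⟩
    obtain ⟨r, hr⟩ := exists_eq_smul_of_admissible V d hd hd0 hGRd χU c' a b (hP₁ a haP) (hP₂ a haP) (hP₁ b hbP) (hP₂ b hbP) ha0
    exact Submodule.mem_span_singleton.mpr ⟨r, hr.symm⟩
  · push Not at h
    refine ⟨0, fun b hbP => ?_⟩
    rw [h b hbP]
    exact Submodule.zero_mem _

end Main

end HodgeCM.Model.MultOne

/-! ## § 8. The four lines of record: (J4-mult1) for `lineOmega_k` / `lineRepOf … k`, any `ωar` with `har` -/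

namespace HodgeCM.Model

open HodgeCM.Model.MultOne HodgeCM.Model.HypCensus HodgeCM.Model.ArchSideTerm MulAction
open Literature.Geometry.ComplexHyperbolic.BallModel (U21 x₀)
open Literature.AlgebraicGeometry.ShimuraVarieties.BallForms (isPullbackCocycle_cotangentCocycle)

section Lines

variable {L : CMField} {ι₁ : L →+* ℂ} (V : HermSpace3 L ι₁) (S : StubTree.SeesawDatum L)
variable
  (hGR : (cmSplittingDatum (L : Type) finProdFinEquiv (frameD V) (frameD_real V) (frameD_ne V) (dW S) (dW_real S) (dW_ne S)).CompatibleSplitting)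
  (hGR₀ : (cmSplittingDatum (L : Type) (e₁) (frameD V) (frameD_real V) (frameD_ne V) (lineVec (L : Type) (dW S 0))
    (fun _ => dW_real S 0) (fun _ => dW_ne S 0)).CompatibleSplitting)
  (hGR₁ : (cmSplittingDatum (L : Type) (e₁) (frameD V) (frameD_real V) (frameD_ne V) (lineVec (L : Type) (dW S 1))
    (fun _ => dW_real S 1) (fun _ => dW_ne S 1)).CompatibleSplitting)
  (hGR₂ : (cmSplittingDatum (L : Type) (e₁) (frameD V) (frameD_real V) (frameD_ne V) (lineVec (L : Type) (dW' S 0))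
    (fun _ => dW'_real S 0) (fun _ => dW'_ne S 0)).CompatibleSplitting)
  (hGR₃ : (cmSplittingDatum (L : Type) (e₁) (frameD V) (frameD_real V) (frameD_ne V) (lineVec (L : Type) (dW' S 1))
    (fun _ => dW'_real S 1) (fun _ => dW'_ne S 1)).CompatibleSplitting)
  (η₀ η₁ η₂ η₃ : CMAdelic (L : Type) (frameD V) × CMAdelicOne (L : Type) →* ℂˣ)
  (hV : IsAnisotropic L V.Hm)
  (ωar : UnitaryGroup.arch (↥(maximalRealSubfield L)) L (IsCMField.complexConj L) 3 V.Hm →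
    (𝓢((Fin 3 → mixedSpace (↥(maximalRealSubfield L))), ℂ) →ₗ[ℂ] 𝓢((Fin 3 → mixedSpace (↥(maximalRealSubfield L))), ℂ)))
  (P : Submodule ℂ (Module.Dual ℂ (Fin 2 → ℂ) →ₗ[ℂ] 𝓢((Fin 3 → mixedSpace (↥(maximalRealSubfield L))), ℂ)))

/-- **(J4-mult1) FOR LINE 0, KERNEL.**  For ANY archimedean operator datum `ωar` with
`har : lineRepOf … 0 ((aa)^𝔸, 1) = ωar aa ⊗ 1` on the elements `aa ∈ U(V)(L ⊗ ℝ)` trivial at the place of `ι₁` (binder-1's `har` at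
`archSideOf …`), every `ℂ`-submodule of families `a : W^∨ →ₗ 𝓢((L⁺ ⊗ ℝ)³)` with (1) `lineOmega_zero u (a ℓ) = a (τ₁^∨ u ℓ)` on `Stab(x₀)`
and (2) `ωar aa (a ℓ) = a ℓ` for those `aa` — e.g. binder-1's `(thetaDistDatumZeroOf …).admFamilies ωar` — has `Module.rank ℂ ≤ 1`:
the RANK form `hrk` of #R123 `multOne_of_rank_le_one`, discharged. -/
theorem rank_le_one_of_lineOmega_zero
    (har : ∀ aa : UnitaryGroup.arch (↥(maximalRealSubfield L)) L (IsCMField.complexConj L) 3 V.Hm,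
      UnitaryGroup.archAt (↥(maximalRealSubfield L)) L (IsCMField.complexConj L) 3 V.Hm (UnitaryGroup.cmPlace (L : Type) ι₁)
          (NumberField.complexConj_smul_infinitePlace (L : Type) _) (IsCMField.complexConj_ne_one (L : Type)) aa = 1 →
      lineRepOf V S hGR hGR₀ hGR₁ hGR₂ hGR₃ η₀ η₁ η₂ η₃ 0
          (HodgeCM.Adelic.regimeEquiv L V.Hm hV
            (UnitaryGroup.archToAdelic (↥(maximalRealSubfield L)) L (IsCMField.complexConj L) 3 V.Hm aa), 1) =
        adelicTensorEnd (K := ↥(maximalRealSubfield L)) (ι := Fin 3) (ωar aa) LinearMap.id)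
    (hP₁ : ∀ a ∈ P, ∀ (u : ↥(stabilizer U21 x₀)) (ℓ : Module.Dual ℂ (Fin 2 → ℂ)),
      lineOmega_zero V S hGR hGR₀ hGR₁ η₀ (u : U21) (a ℓ) = a ((isPullbackCocycle_cotangentCocycle.weightOf x₀).dual u ℓ))
    (hP₂ : ∀ a ∈ P, ∀ aa : UnitaryGroup.arch (↥(maximalRealSubfield L)) L (IsCMField.complexConj L) 3 V.Hm,
      UnitaryGroup.archAt (↥(maximalRealSubfield L)) L (IsCMField.complexConj L) 3 V.Hm (UnitaryGroup.cmPlace (L : Type) ι₁)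
          (NumberField.complexConj_smul_infinitePlace (L : Type) _) (IsCMField.complexConj_ne_one (L : Type)) aa = 1 →
      ∀ ℓ : Module.Dual ℂ (Fin 2 → ℂ), ωar aa (a ℓ) = a ℓ) :
    Module.rank ℂ ↥P ≤ 1 := by
  refine rank_le_one_of_admissible V (dW S 0) (dW_real S 0) (dW_ne S 0) hGR₀ (lineScalar_zero V S hGR hGR₀ hGR₁ η₀)
    (fun aa => archScalar_zeroG V S hGR hGR₀ hGR₁ η₀ (archFrameCongr (L : Type) V.Hm (frameG V) (frameD V) (frame_congr V) aa)) P
    (fun a haP u ℓ => ?_) (fun a haP aa haa ℓ => ?_)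
  · rw [← hP₁ a haP u ℓ, lineOmega_zero, Representation.smulPull_apply, MonoidHom.prod_apply, MonoidHom.one_apply, LinearMap.smul_apply]
  · have h := (har aa haa).symm.trans (lineRepOf_zero_regime_archToAdelicG V S hGR hGR₀ hGR₁ hGR₂ hGR₃ η₀ η₁ η₂ η₃ hV aa)
    have hω := adelicTensorEnd_id_injective (K := ↥(maximalRealSubfield L)) (ι := Fin 3) h
    have h2 := hP₂ a haP aa haa ℓ
    rw [hω, LinearMap.smul_apply] at h2
    exact h2

/-- **(J4-mult1) FOR LINE 1, KERNEL** (as `rank_le_one_of_lineOmega_zero`). -/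
theorem rank_le_one_of_lineOmega_one
    (har : ∀ aa : UnitaryGroup.arch (↥(maximalRealSubfield L)) L (IsCMField.complexConj L) 3 V.Hm,
      UnitaryGroup.archAt (↥(maximalRealSubfield L)) L (IsCMField.complexConj L) 3 V.Hm (UnitaryGroup.cmPlace (L : Type) ι₁)
          (NumberField.complexConj_smul_infinitePlace (L : Type) _) (IsCMField.complexConj_ne_one (L : Type)) aa = 1 →
      lineRepOf V S hGR hGR₀ hGR₁ hGR₂ hGR₃ η₀ η₁ η₂ η₃ 1
          (HodgeCM.Adelic.regimeEquiv L V.Hm hV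
            (UnitaryGroup.archToAdelic (↥(maximalRealSubfield L)) L (IsCMField.complexConj L) 3 V.Hm aa), 1) =
        adelicTensorEnd (K := ↥(maximalRealSubfield L)) (ι := Fin 3) (ωar aa) LinearMap.id)
    (hP₁ : ∀ a ∈ P, ∀ (u : ↥(stabilizer U21 x₀)) (ℓ : Module.Dual ℂ (Fin 2 → ℂ)),
      lineOmega_one V S hGR hGR₀ hGR₁ η₁ (u : U21) (a ℓ) = a ((isPullbackCocycle_cotangentCocycle.weightOf x₀).dual u ℓ))
    (hP₂ : ∀ a ∈ P, ∀ aa : UnitaryGroup.arch (↥(maximalRealSubfield L)) L (IsCMField.complexConj L) 3 V.Hm,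
      UnitaryGroup.archAt (↥(maximalRealSubfield L)) L (IsCMField.complexConj L) 3 V.Hm (UnitaryGroup.cmPlace (L : Type) ι₁)
          (NumberField.complexConj_smul_infinitePlace (L : Type) _) (IsCMField.complexConj_ne_one (L : Type)) aa = 1 →
      ∀ ℓ : Module.Dual ℂ (Fin 2 → ℂ), ωar aa (a ℓ) = a ℓ) :
    Module.rank ℂ ↥P ≤ 1 := by
  refine rank_le_one_of_admissible V (dW S 1) (dW_real S 1) (dW_ne S 1) hGR₁ (lineScalar_one V S hGR hGR₀ hGR₁ η₁)
    (fun aa => archScalar_oneG V S hGR hGR₀ hGR₁ η₁ (archFrameCongr (L : Type) V.Hm (frameG V) (frameD V) (frame_congr V) aa)) P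
    (fun a haP u ℓ => ?_) (fun a haP aa haa ℓ => ?_)
  · rw [← hP₁ a haP u ℓ, lineOmega_one, Representation.smulPull_apply, MonoidHom.prod_apply, MonoidHom.one_apply, LinearMap.smul_apply]
  · have h := (har aa haa).symm.trans (lineRepOf_one_regime_archToAdelicG V S hGR hGR₀ hGR₁ hGR₂ hGR₃ η₀ η₁ η₂ η₃ hV aa)
    have hω := adelicTensorEnd_id_injective (K := ↥(maximalRealSubfield L)) (ι := Fin 3) h
    have h2 := hP₂ a haP aa haa ℓ
    rw [hω, LinearMap.smul_apply] at h2
    exact h2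

/-- **(J4-mult1) FOR LINE 2, KERNEL** (conjugated plane; as `rank_le_one_of_lineOmega_zero`). -/
theorem rank_le_one_of_lineOmega_two
    (har : ∀ aa : UnitaryGroup.arch (↥(maximalRealSubfield L)) L (IsCMField.complexConj L) 3 V.Hm,
      UnitaryGroup.archAt (↥(maximalRealSubfield L)) L (IsCMField.complexConj L) 3 V.Hm (UnitaryGroup.cmPlace (L : Type) ι₁)
          (NumberField.complexConj_smul_infinitePlace (L : Type) _) (IsCMField.complexConj_ne_one (L : Type)) aa = 1 →
      lineRepOf V S hGR hGR₀ hGR₁ hGR₂ hGR₃ η₀ η₁ η₂ η₃ 2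
          (HodgeCM.Adelic.regimeEquiv L V.Hm hV
            (UnitaryGroup.archToAdelic (↥(maximalRealSubfield L)) L (IsCMField.complexConj L) 3 V.Hm aa), 1) =
        adelicTensorEnd (K := ↥(maximalRealSubfield L)) (ι := Fin 3) (ωar aa) LinearMap.id)
    (hP₁ : ∀ a ∈ P, ∀ (u : ↥(stabilizer U21 x₀)) (ℓ : Module.Dual ℂ (Fin 2 → ℂ)),
      lineOmega_two V S hGR hGR₂ hGR₃ η₂ (u : U21) (a ℓ) = a ((isPullbackCocycle_cotangentCocycle.weightOf x₀).dual u ℓ))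
    (hP₂ : ∀ a ∈ P, ∀ aa : UnitaryGroup.arch (↥(maximalRealSubfield L)) L (IsCMField.complexConj L) 3 V.Hm,
      UnitaryGroup.archAt (↥(maximalRealSubfield L)) L (IsCMField.complexConj L) 3 V.Hm (UnitaryGroup.cmPlace (L : Type) ι₁)
          (NumberField.complexConj_smul_infinitePlace (L : Type) _) (IsCMField.complexConj_ne_one (L : Type)) aa = 1 →
      ∀ ℓ : Module.Dual ℂ (Fin 2 → ℂ), ωar aa (a ℓ) = a ℓ) :
    Module.rank ℂ ↥P ≤ 1 := by
  refine rank_le_one_of_admissible V (dW' S 0) (dW'_real S 0) (dW'_ne S 0) hGR₂ (lineScalar_two V S hGR hGR₂ hGR₃ η₂)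
    (fun aa => archScalar_twoG V S hGR hGR₂ hGR₃ η₂ (archFrameCongr (L : Type) V.Hm (frameG V) (frameD V) (frame_congr V) aa)) P
    (fun a haP u ℓ => ?_) (fun a haP aa haa ℓ => ?_)
  · rw [← hP₁ a haP u ℓ, lineOmega_two, Representation.smulPull_apply, MonoidHom.prod_apply, MonoidHom.one_apply, LinearMap.smul_apply]
  · have h := (har aa haa).symm.trans (lineRepOf_two_regime_archToAdelicG V S hGR hGR₀ hGR₁ hGR₂ hGR₃ η₀ η₁ η₂ η₃ hV aa)
    have hω := adelicTensorEnd_id_injective (K := ↥(maximalRealSubfield L)) (ι := Fin 3) h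
    have h2 := hP₂ a haP aa haa ℓ
    rw [hω, LinearMap.smul_apply] at h2
    exact h2

/-- **(J4-mult1) FOR LINE 3, KERNEL** (conjugated plane; as `rank_le_one_of_lineOmega_zero`). -/
theorem rank_le_one_of_lineOmega_three
    (har : ∀ aa : UnitaryGroup.arch (↥(maximalRealSubfield L)) L (IsCMField.complexConj L) 3 V.Hm,
      UnitaryGroup.archAt (↥(maximalRealSubfield L)) L (IsCMField.complexConj L) 3 V.Hm (UnitaryGroup.cmPlace (L : Type) ι₁)
          (NumberField.complexConj_smul_infinitePlace (L : Type) _) (IsCMField.complexConj_ne_one (L : Type)) aa = 1 →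
      lineRepOf V S hGR hGR₀ hGR₁ hGR₂ hGR₃ η₀ η₁ η₂ η₃ 3
          (HodgeCM.Adelic.regimeEquiv L V.Hm hV
            (UnitaryGroup.archToAdelic (↥(maximalRealSubfield L)) L (IsCMField.complexConj L) 3 V.Hm aa), 1) =
        adelicTensorEnd (K := ↥(maximalRealSubfield L)) (ι := Fin 3) (ωar aa) LinearMap.id)
    (hP₁ : ∀ a ∈ P, ∀ (u : ↥(stabilizer U21 x₀)) (ℓ : Module.Dual ℂ (Fin 2 → ℂ)),
      lineOmega_three V S hGR hGR₂ hGR₃ η₃ (u : U21) (a ℓ) = a ((isPullbackCocycle_cotangentCocycle.weightOf x₀).dual u ℓ))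
    (hP₂ : ∀ a ∈ P, ∀ aa : UnitaryGroup.arch (↥(maximalRealSubfield L)) L (IsCMField.complexConj L) 3 V.Hm,
      UnitaryGroup.archAt (↥(maximalRealSubfield L)) L (IsCMField.complexConj L) 3 V.Hm (UnitaryGroup.cmPlace (L : Type) ι₁)
          (NumberField.complexConj_smul_infinitePlace (L : Type) _) (IsCMField.complexConj_ne_one (L : Type)) aa = 1 →
      ∀ ℓ : Module.Dual ℂ (Fin 2 → ℂ), ωar aa (a ℓ) = a ℓ) :
    Module.rank ℂ ↥P ≤ 1 := by
  refine rank_le_one_of_admissible V (dW' S 1) (dW'_real S 1) (dW'_ne S 1) hGR₃ (lineScalar_three V S hGR hGR₂ hGR₃ η₃)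
    (fun aa => archScalar_threeG V S hGR hGR₂ hGR₃ η₃ (archFrameCongr (L : Type) V.Hm (frameG V) (frameD V) (frame_congr V) aa)) P
    (fun a haP u ℓ => ?_) (fun a haP aa haa ℓ => ?_)
  · rw [← hP₁ a haP u ℓ, lineOmega_three, Representation.smulPull_apply, MonoidHom.prod_apply, MonoidHom.one_apply, LinearMap.smul_apply]
  · have h := (har aa haa).symm.trans (lineRepOf_three_regime_archToAdelicG V S hGR hGR₀ hGR₁ hGR₂ hGR₃ η₀ η₁ η₂ η₃ hV aa)
    have hω := adelicTensorEnd_id_injective (K := ↥(maximalRealSubfield L)) (ι := Fin 3) h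
    have h2 := hP₂ a haP aa haa ℓ
    rw [hω, LinearMap.smul_apply] at h2
    exact h2

end Lines

end HodgeCM.Model

-- port_pkg: scope closed for this part
end
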